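import Literature.IUT.HodgeTheaters.InitialThetaDataTorsionMonodromyModelKLevel
import Literature.IUT.HodgeTheaters.ThetaGeometryInhabited
import Literature.IUT.HodgeTheaters.InitialThetaDataTorsionProofs
import Literature.NumberTheory.EllipticCurves.TorsionCardinality
import HarnessLib

/-!
# [IUTchI] Def 3.1 (b)(c)(d) / Def 6.1 (v): the assembled semidirect `ThetaGeometry`, the re-geometrised initial
# Θ-datum and its `l`-TORSION MONODROMY TERM (NV-L5 witness «TorsionMonodromy-NV», part 3: definitions)

S. Mochizuki, *Inter-universal Teichmüller theory I*, kurims manuscript (May 2020), §3 Definition 3.1 (c) p. 62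
«`K ⊆ F̄` … the finite Galois extension of `F` determined by the kernel of this homomorphism», (d) p. 62 «`C̲_K` …
of type `(1, l-tors)±` … with `K`-core `C_K := C_F ×_F K`», §6 Definition 6.1 (v) p. 158 «the outer homomorphism
`Aut(𝒟^{⊚±}) → GL₂(𝔽_l)/{±1}` arising from the `l`-torsion points of the elliptic curve `E_F` [i.e., from the Galois
action on `Δ_X^{ab} ⊗ 𝔽_l`] … the rank one quotient of `Δ_X^{ab} ⊗ 𝔽_l` that gives rise to the covering `X̲_K → X_K`»
([IUTchI] Def 3.1 (c)(d) p.62, Def 6.1 (v) p.158) [claim: Mochizuki2012, status: disputed] (D-0012 claim key; series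
status DISPUTED — a MODEL of the cell's `π₁`-interface structures; nothing of the series is asserted; no side taken
on [IUTchIII] Cor. 3.12).

## WHAT (continuing `…Model.lean` / `…ModelKLevel.lean`)

* `embK : G_K × (E_F[l] ⋊ {±1}) ↪ Π_{C_F} = E_F[l] ⋊ (G_F × {±1})`, `(σ, ⟨t, u⟩) ↦ ⟨t, (σ, u)⟩` — a HOMOMORPHISM because
  `G_K` acts trivially on `E_F[l](F̄)` (`hK` = Def 3.1 (c)) — with image `Π_{C_F} ×_{G_F} G_K` and
  `embK(Π_{X_K}) = Π_{X_F} ∩ Π_{C_K}`;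
* `geometryOf` — every field of abc-iut-L5-t2's `ThetaGeometry (F̄ ≃ₐ[F] F̄) G_K l` for the semidirect model;
* `InitialThetaData.regeom D₀ := { D₀ with geom := geometryOf … }` — ANY initial Θ-datum (arithmetic fields (a)–(c),
  (e) untouched) re-geometrised by the model, every hypothesis DISCHARGED from `D₀` (`hK` by abc-iut-L5-t2's
  `mem_galoisSubgroupOf_iff_fixesTorsion`, `#E_F[l](F̄) = l²` by the tree's `WeierstrassCurve.card_torsionBy_eq_sq`
  (Silverman AEC III.6.4), the line generator from `imageContainsSL2`);
* **`InitialThetaData.torsionMonodromyRegeom D₀ : D₀.regeom.TorsionMonodromy`** — the `l`-TORSION MONODROMY TERM of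
  abc-iut-L5-t8's interface datum: `τ ⟨t, (σ, u)⟩ := t ∈ E_F[l](F̄)` (the cocycle law IS the semidirect multiplication on
  `Π_{X_F}`), `gen := g`, and `Π_{X̲_K} = G_K × (ℤ·g ⋊ 1)` is cut out by `τ ∈ ℤ·gen`.
Theorems (non-vacuity for every `D₀` and at `InitialThetaData.ofArith`; Def 6.1 (v) surjectivity firing with no
binder; the sign law `τ(c k c⁻¹) = −τ(k)` of the involution) are in the proof-only companion `…ModelProofs.lean`.

HONEST LABEL.  A MODEL (non-vacuity evidence for the binder `Nonempty D.TorsionMonodromy`): the `Π_{C_F}`-module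
`Δ_X^{ab} ⊗ 𝔽_l ≅ E_F[l](F̄)` with its Galois action and sign IS the curve's; everything else is synthetic; `G_K` acts
trivially on `E_F[l]` at the `K`-level BY Def 3.1 (c).  Instantiated ≠ endorsed; typed ≠ proved; no side taken on
[IUTchIII] Cor. 3.12.
-/

noncomputable section

namespace Literature.IUT.HodgeTheaters

universe u

namespace TorsionMonodromyModel

open Literature.AnabelianGeometry.AbsoluteAnabelian Topology
open Literature.AnabelianGeometry.EtaleTheta.SettingModel
open scoped WeierstrassCurve.Affine Classical

/-! ## The embedding `Π_{C_K} ↪ Π_{C_F}` and the assembled `ThetaGeometry` -/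

section Geometry

variable {F : Type u} (K : Type u) {Fbar : Type u} [Field F] [Field K] [Field Fbar] [Algebra F Fbar]
  [Algebra K Fbar] (E : WeierstrassCurve F) (l : ℕ)

/-- A prime `l ≥ 5` is prime to `6`. [cite: Mochizuki2012, IUTchI Def 3.1 (c) p.62] -/
theorem coprime_six_of_prime (hl : l.Prime) (h5 : 5 ≤ l) : l.Coprime 6 := by
  rw [show (6 : ℕ) = 2 * 3 by norm_num, Nat.coprime_mul_iff_right, Nat.coprime_primes hl Nat.prime_two,
    Nat.coprime_primes hl Nat.prime_three]
  omega

variable {K E l}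

/-- **`embK : Π_{C_K} = G_K × (E_F[l] ⋊ {±1}) ↪ Π_{C_F} = E_F[l] ⋊ (G_F × {±1})`**, `(σ, ⟨t, u⟩) ↦ ⟨t, (σ, u)⟩` — a
HOMOMORPHISM because `G_K` acts trivially on `E_F[l](F̄)` (`hK`, Def 3.1 (c)). [cite: Mochizuki2012, IUTchI Def 3.1 (d) p.62] -/
def embK (hK : ∀ σ ∈ galoisSubgroupOf F K Fbar, FixesTorsion E l σ) :
    (galoisSubgroupOf F K Fbar × Dih E Fbar l) →* PiC F E Fbar l where
  toFun x := ⟨x.2.left, ((x.1 : Fbar ≃ₐ[F] Fbar), x.2.right)⟩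
  map_one' := rfl
  map_mul' x y := by
    refine SemidirectProduct.ext ?_ rfl
    show x.2.left * sgnRep E Fbar l x.2.right y.2.left =
      x.2.left * act F E Fbar l ((x.1 : Fbar ≃ₐ[F] Fbar), x.2.right) y.2.left
    rw [act, MonoidHom.noncommCoprod_apply, MulAut.mul_apply, torsRep_apply_of_fixesTorsion _ _ _ (hK _ x.1.2)]

/-- [cite: Mochizuki2012, IUTchI Def 3.1 (d) p.62] -/
@[simp] theorem embK_left (hK : ∀ σ ∈ galoisSubgroupOf F K Fbar, FixesTorsion E l σ)
    (x : galoisSubgroupOf F K Fbar × Dih E Fbar l) : (embK hK x).left = x.2.left := rfl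

/-- [cite: Mochizuki2012, IUTchI Def 3.1 (d) p.62] -/
@[simp] theorem embK_right (hK : ∀ σ ∈ galoisSubgroupOf F K Fbar, FixesTorsion E l σ)
    (x : galoisSubgroupOf F K Fbar × Dih E Fbar l) : (embK hK x).right = ((x.1 : Fbar ≃ₐ[F] Fbar), x.2.right) := rfl

/-- `embK` is injective. [cite: Mochizuki2012, IUTchI Def 3.1 (d) p.62] -/
theorem embK_injective (hK : ∀ σ ∈ galoisSubgroupOf F K Fbar, FixesTorsion E l σ) :
    Function.Injective (embK hK) := by
  rintro ⟨a, b⟩ ⟨a', b'⟩ h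
  have h1 := congrArg SemidirectProduct.left h
  have h2 := congrArg SemidirectProduct.right h
  simp only [embK_left, embK_right, Prod.mk.injEq] at h1 h2
  exact Prod.ext (Subtype.ext h2.1) (SemidirectProduct.ext h1 h2.2)

/-- `x ∈ Im(embK) ↔ aug x ∈ G_K`. [cite: Mochizuki2012, IUTchI Def 3.1 (d) p.62] -/
theorem mem_range_embK_iff (hK : ∀ σ ∈ galoisSubgroupOf F K Fbar, FixesTorsion E l σ) (x : PiC F E Fbar l) :
    x ∈ (embK hK).range ↔ x.right.1 ∈ galoisSubgroupOf F K Fbar := by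
  constructor
  · rintro ⟨y, rfl⟩
    exact y.1.2
  · intro hx
    exact ⟨(⟨x.right.1, hx⟩, ⟨x.left, x.right.2⟩), SemidirectProduct.ext rfl (Prod.ext rfl rfl)⟩

/-- `embK` is continuous. [cite: Mochizuki2012, IUTchI Def 3.1 (d) p.62] -/
theorem embK_continuous (hK : ∀ σ ∈ galoisSubgroupOf F K Fbar, FixesTorsion E l σ) : Continuous (embK hK) := by
  refine (Semidirect.continuous_iff_left_right (PiC.isInducing E Fbar l)).2 ⟨?_, ?_⟩
  · exact (continuous_of_discreteTopology : Continuous (SemidirectProduct.left : Dih E Fbar l → Tors E Fbar l)).comp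
      continuous_snd
  · exact (continuous_subtype_val.comp continuous_fst).prodMk
      ((continuous_of_discreteTopology : Continuous (SemidirectProduct.right : Dih E Fbar l → ℤˣ)).comp continuous_snd)

variable (K E l) in
/-- **The semidirect model of the `π₁`-interface of [IUTchI] Def 3.1 (b)(d)(f)** for `G_F = Gal(F̄/F) ⊇ G_K = Gal(F̄/K)`
with `G_K` acting trivially on `E_F[l](F̄)` (`hK`), `l ≥ 5` prime, `#E_F[l](F̄) = l²` (`hcard`) and a generator
`g ≠ 1` of the line of the rank-one quotient: `Π_{C_F} := E_F[l](F̄) ⋊ (G_F × {±1})` with the GENUINE Galois action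
and sign, `Π_{X_F} = E_F[l] ⋊ (G_F × 1)`, `Π_{C_K} = G_K × (E_F[l] ⋊ {±1})` embedded by `embK`, `Π_{X̲_K} = G_K × ℤ·g`.
Every field of `ThetaGeometry` holds. [cite: Mochizuki2012, IUTchI Def 3.1 p.61–63] -/
def geometryOf [Algebra F K] [IsScalarTower F K Fbar] [IsGalois F Fbar] [E.IsElliptic]
    (hK : ∀ σ ∈ galoisSubgroupOf F K Fbar, FixesTorsion E l σ) (hl : l.Prime) (h5 : 5 ≤ l)
    (hcard : Nat.card (Tors E Fbar l) = l ^ 2) (g : Tors E Fbar l) (hg : g ≠ 1) :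
    ThetaGeometry (Fbar ≃ₐ[F] Fbar) (galoisSubgroupOf F K Fbar) l :=
  haveI : NeZero l := ⟨hl.ne_zero⟩
  letI : CompactSpace (galoisSubgroupOf F K Fbar) :=
    isCompact_iff_compactSpace.mp (ThetaGeometryModel.isClosed_galoisSubgroupOf F K Fbar).isCompact
  { extF := ext F E Fbar l
    galIso := MulEquiv.refl _
    galIso_continuous := ⟨continuous_id, continuous_id⟩
    PiX := PiX F E Fbar l
    PiX_isOpen := PiX_isOpen E Fbar l
    PiX_normal := PiX_normal E Fbar l
    PiX_index := PiX_index E Fbar l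
    aug_PiX := by
      rw [eq_top_iff]
      intro σ _
      exact ⟨SemidirectProduct.inr (σ, 1), inr_mem_PiX E Fbar l σ, rfl⟩
    pe := pedOf (galoisSubgroupOf F K Fbar) g h5 (coprime_six_of_prime l hl h5)
    pe_l := rfl
    embK := embK hK
    embK_continuous := embK_continuous hK
    embK_injective := embK_injective hK
    embK_range := by
      ext x
      exact mem_range_embK_iff hK x
    galKIso := MulEquiv.refl _
    aug_compat := fun _ => rfl
    embK_PiX := by
      ext x
      constructor
      · rintro ⟨y, hy, rfl⟩
        exact ⟨(mem_PiX_iff E Fbar l _).mpr ((Dih.mem_dX_iff _).mp (mem_lift.mp hy)), y, rfl⟩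
      · rintro ⟨hx, y, rfl⟩
        exact ⟨y, mem_lift.mpr ((Dih.mem_dX_iff _).mpr ((mem_PiX_iff E Fbar l _).mp hx)), rfl⟩
    PiXbar_relIndex := by
      rw [pedOf_PiXbar]
      show (lift _ (Dih.dXbar F E g)).relIndex (lift _ (Dih.dX F E)) = l
      rw [lift_relIndex, Dih.dXbar_relIndex_dX hl hcard hg]
    aug_PiXbar := by
      rw [pedOf_PiXbar]
      exact fst_lift_surjective _ _
    PiXbar_relIndex_PiCbar := by
      rw [pedOf_PiXbar]
      show (lift _ (Dih.dXbar F E g)).relIndex (lift _ (Dih.dC F E g)) = 2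
      rw [lift_relIndex, Dih.dXbar_relIndex_dC hl hcard hg]
    not_PiCbar_le_PiX := by
      intro h
      apply Dih.not_dC_le_dX (F := F) (E := E) g
      intro d hd
      exact h (show ((1 : galoisSubgroupOf F K Fbar), d) ∈ lift _ (Dih.dC F E g) from hd) }

/-- The cocycle identity of the model on `Π_{X_F}`: `(gh).left = g.left · σ_g(h.left)`, on points.
[cite: Mochizuki2012, IUTchI Def 6.1 (v) p.158] -/
theorem pt_left_mul_of_right_snd_eq_one {g : PiC F E Fbar l} (hg : g.right.2 = 1) (h : PiC F E Fbar l) :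
    Tors.pt (g * h).left = Tors.pt g.left + galoisAct E g.right.1 (Tors.pt h.left) := by
  rw [SemidirectProduct.mul_left, Tors.pt_mul, pt_act, hg, Units.val_one, one_smul]

end Geometry

end TorsionMonodromyModel

/-! ## Re-geometrised initial Θ-data and the `l`-torsion monodromy TERM -/

namespace InitialThetaData

open TorsionMonodromyModel
open scoped WeierstrassCurve.Affine Classical

variable {F K Fbar : Type u} [Field F] [NumberField F] [Field K] [NumberField K] [Algebra F K] [Field Fbar]
  [Algebra F Fbar] [Algebra K Fbar] {E : WeierstrassCurve F} [E.IsElliptic] {l : ℕ} {Pb : BadPlacePredicates K}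

/-- A nonzero `l`-torsion point exists (the first basis vector of Def 3.1 (c) `ImageContainsSL2`).
[cite: Mochizuki2012, IUTchI Def 3.1 (c) p.62] -/
theorem exists_torsion_ne_zero (D₀ : InitialThetaData F K Fbar E l Pb) :
    ∃ P : GeomPoints Fbar E, (l : ℤ) • P = 0 ∧ P ≠ 0 := by
  obtain ⟨P, Q, hP, -, hind, -, -⟩ := D₀.imageContainsSL2.exists_basis
  refine ⟨P, hP, fun h0 => ?_⟩
  have h1 : (l : ℤ) ∣ 1 := (hind 1 0 (by rw [h0, smul_zero, zero_smul, add_zero])).1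
  have := Int.eq_one_of_dvd_one (Int.natCast_nonneg l) h1
  have h5 := D₀.five_le_l
  omega

/-- `#E_F[l](F̄) = l²` for an initial Θ-datum (`F̄` algebraically closed of characteristic `0`; Silverman AEC III.6.4,
the tree's `WeierstrassCurve.card_torsionBy_eq_sq`). [cite: Mochizuki2012, IUTchI Def 3.1 (c) p.62] -/
theorem card_tors_eq (D₀ : InitialThetaData F K Fbar E l Pb) : Nat.card (Tors E Fbar l) = l ^ 2 := by
  haveI := D₀.isAlgClosure
  haveI : IsAlgClosed Fbar := IsAlgClosure.isAlgClosed F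
  haveI : CharZero Fbar := charZero_of_injective_algebraMap (algebraMap F Fbar).injective
  have hl : (l : Fbar) ≠ 0 := by exact_mod_cast D₀.l_prime.ne_zero
  rw [Nat.card_congr Multiplicative.toAdd]
  exact WeierstrassCurve.card_torsionBy_eq_sq (E := E.baseChange Fbar) hl

/-- The chosen generator `g` of the line `𝔽_l·gen` of the rank-one quotient (a nonzero `l`-torsion point of Def 3.1 (c),
as an element of the model's normal factor). [cite: Mochizuki2012, IUTchI Def 3.1 (d) p.62] -/
def lineGen (D₀ : InitialThetaData F K Fbar E l Pb) : Tors E Fbar l :=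
  Tors.ofPt D₀.exists_torsion_ne_zero.choose D₀.exists_torsion_ne_zero.choose_spec.1

/-- `g ≠ 1`. [cite: Mochizuki2012, IUTchI Def 3.1 (d) p.62] -/
theorem lineGen_ne_one (D₀ : InitialThetaData F K Fbar E l Pb) : D₀.lineGen ≠ 1 := by
  rw [Ne, ← Tors.pt_eq_zero_iff, lineGen, Tors.pt_ofPt]
  exact D₀.exists_torsion_ne_zero.choose_spec.2

/-- `G_K` acts trivially on `E_F[l](F̄)` (Def 3.1 (c) `range_K_iff`; abc-iut-L5-t2's `mem_galoisSubgroupOf_iff_fixesTorsion`).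
[cite: Mochizuki2012, IUTchI Def 3.1 (c) p.62] -/
theorem fixesTorsion_of_mem_galoisSubgroupOf (D₀ : InitialThetaData F K Fbar E l Pb) :
    ∀ σ ∈ galoisSubgroupOf F K Fbar, FixesTorsion E l σ :=
  fun σ hσ => (D₀.mem_galoisSubgroupOf_iff_fixesTorsion σ).mp hσ

/-- **The re-geometrised initial Θ-datum**: `D₀` with its `π₁`-interface field `geom` REPLACED by the semidirect
model `Π_{C_F} := E_F[l](F̄) ⋊ (G_F × {±1})` (all arithmetic fields (a)–(c), (e) of Def 3.1 kept; the model's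
hypotheses discharged from `D₀`: `G_K` fixes `E_F[l]` by `range_K_iff`, `#E_F[l](F̄) = l²`, `l ≥ 5` prime).
[cite: Mochizuki2012, IUTchI Def 3.1 p.61–63] -/
def regeom (D₀ : InitialThetaData F K Fbar E l Pb) : InitialThetaData F K Fbar E l Pb :=
  haveI := D₀.isAlgClosure
  haveI := D₀.isScalarTower
  { D₀ with
    geom := geometryOf K E l D₀.fixesTorsion_of_mem_galoisSubgroupOf D₀.l_prime D₀.five_le_l D₀.card_tors_eq
      D₀.lineGen D₀.lineGen_ne_one }

/-- **The `l`-TORSION MONODROMY TERM of the re-geometrised datum** ([IUTchI] Def 3.1 (c)(d) / [EtTh] Def 2.1 / Def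
6.1 (v), abc-iut-L5-t8's interface datum `TorsionMonodromy`): `τ ⟨t, (σ, u)⟩ := t ∈ E_F[l](F̄)` (the cocycle law IS
the semidirect multiplication on `Π_{X_F} = E_F[l] ⋊ (G_F × 1)`), `gen := g`, and `Π_{X̲_K} = G_K × (ℤ·g ⋊ 1)` is cut out
by `τ ∈ ℤ·gen`. [cite: Mochizuki2012, IUTchI Def 6.1 (v) p.158] -/
def torsionMonodromyRegeom (D₀ : InitialThetaData F K Fbar E l Pb) : D₀.regeom.TorsionMonodromy :=
  haveI := D₀.isAlgClosure
  haveI := D₀.isScalarTower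
  haveI : NeZero l := ⟨D₀.l_prime.ne_zero⟩
  { tau := fun x => Tors.pt (x : TorsionMonodromyModel.PiC F E Fbar l).left
    tau_torsion := fun g _ => Tors.torsion_pt _
    tau_mul := fun g hg h _ =>
      pt_left_mul_of_right_snd_eq_one ((TorsionMonodromyModel.mem_PiX_iff E Fbar l _).mp hg) h
    tau_surjOn := by
      intro P hP
      refine ⟨(SemidirectProduct.inl (Tors.ofPt P hP) : TorsionMonodromyModel.PiC F E Fbar l),
        ⟨TorsionMonodromyModel.inl_mem_PiX E Fbar l _, ?_⟩, ?_⟩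
      · exact (TorsionMonodromyModel.mem_geom_ext_iff E Fbar l _).mpr rfl
      · show Tors.pt (SemidirectProduct.inl (Tors.ofPt P hP) : TorsionMonodromyModel.PiC F E Fbar l).left = P
        rw [SemidirectProduct.left_inl, Tors.pt_ofPt]
    gen := Tors.pt D₀.lineGen
    gen_torsion := Tors.torsion_pt _
    gen_ne_zero := by
      rw [Ne, Tors.pt_eq_zero_iff]
      exact D₀.lineGen_ne_one
    mem_PiXund_iff := by
      haveI : CompactSpace (galoisSubgroupOf F K Fbar) :=
        isCompact_iff_compactSpace.mp (ThetaGeometryModel.isClosed_galoisSubgroupOf F K Fbar).isCompact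
      intro k hk
      obtain ⟨hkX, y, rfl⟩ := hk
      have hy2 : y.2.right = 1 := (TorsionMonodromyModel.mem_PiX_iff E Fbar l _).mp hkX
      change TorsionMonodromyModel.embK D₀.fixesTorsion_of_mem_galoisSubgroupOf y ∈
          (TorsionMonodromyModel.pedOf (galoisSubgroupOf F K Fbar) D₀.lineGen D₀.five_le_l
            (coprime_six_of_prime l D₀.l_prime D₀.five_le_l)).PiXbar.map
            (TorsionMonodromyModel.embK D₀.fixesTorsion_of_mem_galoisSubgroupOf) ↔
        ∃ a : ℤ, Tors.pt (TorsionMonodromyModel.embK D₀.fixesTorsion_of_mem_galoisSubgroupOf y).left =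
          a • Tors.pt D₀.lineGen
      rw [pedOf_PiXbar, embK_left]
      constructor
      · rintro ⟨z, hz, hzy⟩
        obtain rfl : z = y := embK_injective _ hzy
        obtain ⟨a, ha⟩ := Subgroup.mem_zpowers_iff.mp ((Dih.mem_dXbar_iff _ _).mp (mem_lift.mp hz)).2
        exact ⟨a, by rw [← ha, Tors.pt_zpow]⟩
      · rintro ⟨a, ha⟩
        refine ⟨y, mem_lift.mpr ((Dih.mem_dXbar_iff _ _).mpr ⟨hy2, Subgroup.mem_zpowers_iff.mpr ⟨a, ?_⟩⟩), rfl⟩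
        exact Tors.pt_injective (by rw [Tors.pt_zpow, ha]) }

end InitialThetaData

end Literature.IUT.HodgeTheaters

end
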